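import Literature.MathematicalPhysics.QuantumFieldTheory.Balaban1983to89.B9Thm313WholeDirInput
import Literature.MathematicalPhysics.QuantumFieldTheory.Balaban1983to89.B9Thm312WholeDirB

/-!
# `Balaban1983to89.B9Thm313WholeDirInputB` — [B9] Theorem 3.13 (p. 426): the (3.44) ∕ (3.45) members of 𝔊 = 𝔓G₁ on the direction-pair family WITH
# ε-INDEXED INPUT-STEP ∕ INPUT-LETTER CONSTANTS AND β-INDEXED PROBE-STEP CONSTANTS (the twins of `B9Thm313WholeDirInput.GG_input44m ∕ 45m ∕
# 44Family ∕ 45Family_of_letters` for the reshaped schemas `B9Thm312WholeDirB.StepDirB` and `Letters313IMB`; located remarks U2 ∕ U3,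
# referee WATCH-A6-N06-STEPDIR-EPSUNIFORM)

T. Bałaban, *Propagators for lattice gauge theories in a background field*, Commun. Math. Phys. **99** (1985) 389–434
[`Balaban1985BackgroundPropagators`, "B9"]; [4] = T. Bałaban, *Propagators and renormalization transformations for lattice gauge
theories. II*, Commun. Math. Phys. **96** (1984) 223–250 [`Balaban1984PropagatorsII`].

statement-level skeleton of published theorems with citation tags; proofs where landed; nothing here is a claim about the Yang–Mills
mass gap

THE POINT.  Row 21's input letters `Letters313IM` carry ONE constant B_r for RDv\*G₁∇\*_{U,μ} : `bHX ε` → `bHW ε` and ONE θ_v for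
(Δ′_π + Δ⁽²⁾_π)G₀D : `bHW ε` → 𝔠⁽¹⁾ for all ε > 0, and the step schema `StepDir` ONE θ_H — print's input ∕ Hölder constants B′₀(ε), B₀(β) depend on
ε resp. β (Theorem 3.1, pp. 397–398).  THIS FILE registers `Letters313IMB … (Br θv : ℝ → ℝ) …` (VERBATIM `Letters313IM` with `rgdd μ ε` at B_r(ε)
and `tDv ε` at θ_v(ε)) and re-proves the four (3.44) ∕ (3.45) theorems of `B9Thm313WholeDirInput` against `StepDirB` and `Letters313IMB`: the
constants become `constI44 θ θ_D (θ_I ε) (θ_v ε) B₀ B₃ (B_i ε) (B_d ε) (B_r ε) Λ κ c` and `constI45 θ θ_M (θ_v (β+ε)) B₀ B₃ (B_h β) (B_i2 ε β) (B_d2 ε β)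
(B_q β) (B_r (β+ε)) Λ κ c`, θ_M = max(θ_H β, θ_I (β+ε)) (the (3.45) member reads the probe step at β and the input step at β + ε).  Proofs VERBATIM
the originals with the constants evaluated pointwise.  COUNT-NEUTRAL; N06 is NOT discharged; one finite lattice at a time; nothing continuum,
nothing about the mass gap.  Cell `pub-ymgap` (HUMAN RULING D-0062), Track A node N06 [B9], rows 20–21 (bundle F7), seat `pub-ymgap-dag-n06-l`
(g12), 2026-08-27.
-/

namespace Literature.MathematicalPhysics.QuantumFieldTheory.Balaban1983to89.B9Thm313WholeDirInputB

open Literature.MathematicalPhysics.QuantumFieldTheory.Balaban1983to89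
open Finset B6RandomWalk B6RandomWalkHom B9Thm34Ext B9Thm37GlueCor36 B11SectG B9SectDSup
open B9Thm37AllNorms B9Thm37AllNormsInstances B9Thm312Whole B9Thm312WholeLeaf B9Thm312WholeLeft B9Thm313Whole B9Thm313WholeLeft
open B9RWSums343Holder B9Ineq347 B9Thm312WholeClasses B9Thm312WholeHolder B9Thm312WholeHHolder B9Thm313WholeHolder B9Thm313WholeInput
open B9RWSums346SecondDiff B9RWSums344InputFam B9Thm312WholeDir B9Thm313WholeDir B9Thm313WholeDirInput B9Thm312WholeDirB

noncomputable section

section OneMember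

variable {g : B9.Geometry} {B : B9.Backgrounds} {X Y Z W PX PY P : Type}
variable [Fintype X] [Fintype Y] [Fintype Z] [Fintype W] [Fintype PX] [Fintype PY] [Fintype P] [Fintype g.Site]
variable {R₀ : ℝ} {H₀ : Prop}

/-! ## §1 The input-class letters with ε-indexed constants (printed type; nothing asserted) -/

/-- **THE INPUT-CLASS LETTERS OF THE REDUCTION, X-INPUTS, PER DIRECTION, WITH ε-INDEXED CONSTANTS** — verbatim `B9Thm313WholeDir.Letters313IM`
except that `rgdd μ ε` (RDv\*G₁∇\*_{U,μ} : `bHX ε` → `bHW ε`) carries B_r(ε) and `tDv ε` (the step (Δ′_π + Δ⁽²⁾_π)G₀D out of `bHW ε`) carries θ_v(ε)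
(print: B′₀(ε) → ∞ as ε → 0, (3.44)–(3.45) p. 398).  NOTHING ASSERTED: these are the instance's.
[cite: Balaban1985BackgroundPropagators, Thm 3.13 p.426 + (3.152)–(3.153) p.426 + (3.44)–(3.45) p.398 + (3.39)–(3.41) p.397 + (3.130)–(3.131) pp.421–422; Balaban1984PropagatorsII, (2.26) p.228 + (2.51)–(2.52) p.232] -/
structure Letters313IMB (𝔬 : Ops g B X Y Z W) (𝔭 : HolderProbes g B X Y PX PY) (Dd Dds : B.Cfg → P → Module.End ℝ (X → ℝ))
    (R₀ : ℝ) (H₀ : Prop) (hlen : ∀ y : g.Site, 0 ≤ g.len y) (bHX : ℝ → BlockNorm (toB6 g R₀ H₀) (X → ℝ))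
    (bHW : ℝ → BlockNorm (toB6 g R₀ H₀) (W → ℝ)) (Br θv : ℝ → ℝ) (Bd : ℝ → ℝ) (Bd2 : ℝ → ℝ → ℝ) (δ₃ δK : ℝ)
    (U : B.Cfg) : Prop where
  rgdd : ∀ (μ : P) (ε : ℝ), 0 < ε → HasMaj (bHX ε) (bHW ε) (𝔬.R U ∘ₗ 𝔬.Dvstar U ∘ₗ 𝔬.G1 U ∘ₗ Dds U μ)
    (fun a b => Br ε * Real.exp (-(δ₃ * g.dist a b)))
  dgDvd : ∀ (ν : P) (ε : ℝ), 0 < ε → ε ≤ 1 → HasMaj (bHW ε) (BlockNorm.ofBlocks (toB6 g R₀ H₀) 𝔬.blk)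
    (Dd U ν ∘ₗ (𝔬.G0 U ∘ₗ 𝔬.Dv U)) (fun (a b : g.Site) => Bd ε * Real.exp (-(δ₃ * g.dist a b)))
  pdgDvd : ∀ (ν : P) (ε β : ℝ), 0 < ε → ε ≤ 1 → 0 ≤ β → β < 1 → HasMaj (bHW (β + ε)) (BlockNorm.ofBlocks (toB6 g R₀ H₀) 𝔭.blkPX)
    ((𝔭.ΦX U β ∘ₗ Dd U ν) ∘ₗ (𝔬.G0 U ∘ₗ 𝔬.Dv U))
    (fun (a b : g.Site) => Bd2 ε β * g.len a ^ (-β) * Real.exp (-(δ₃ * g.dist a b)))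
  tDv : ∀ ε : ℝ, 0 < ε → HasMaj (bHW ε) (cNormR R₀ H₀ 𝔬.blk hlen 1) ((𝔬.Tpi U + 𝔬.T2 U) ∘ₗ (𝔬.G0 U ∘ₗ 𝔬.Dv U))
    (fun a b => θv ε * Real.exp (-(δK * g.dist a b)))
  domX : ∀ ε : ℝ, 0 < ε → ∀ (y : g.Site) (μ : X → ℝ), (BlockNorm.ofBlocks (toB6 g R₀ H₀) 𝔬.blk).loc y μ ≤ (bHX ε).loc y μ
  locX : ∀ ε : ℝ, 0 < ε → ∀ (y : g.Site) (μ : X → ℝ),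
    (bHX ε).IsLoc y μ → (BlockNorm.ofBlocks (toB6 g R₀ H₀) 𝔬.blk).IsLoc y μ

omit [Fintype Y] [Fintype Z] [Fintype W] [Fintype PY] [Fintype P] in
/-- The registered one-constant letters from the ε-indexed ones under uniform bounds («constants by choice»).
[cite: Balaban1985BackgroundPropagators, Thm 3.13 p.426 (bookkeeping)] -/
theorem letters313IM_of_IMB {𝔬 : Ops g B X Y Z W} {𝔭 : HolderProbes g B X Y PX PY} {Dd Dds : B.Cfg → P → Module.End ℝ (X → ℝ)}
    {hlen : ∀ y : g.Site, 0 ≤ g.len y} {bHX : ℝ → BlockNorm (toB6 g R₀ H₀) (X → ℝ)} {bHW : ℝ → BlockNorm (toB6 g R₀ H₀) (W → ℝ)}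
    {Br θv Bd : ℝ → ℝ} {Bd2 : ℝ → ℝ → ℝ} {δ₃ δK Bru θvu : ℝ} {U : B.Cfg}
    (hBr : ∀ ε : ℝ, 0 < ε → Br ε ≤ Bru) (hθv : ∀ ε : ℝ, 0 < ε → θv ε ≤ θvu)
    (h : Letters313IMB 𝔬 𝔭 Dd Dds R₀ H₀ hlen bHX bHW Br θv Bd Bd2 δ₃ δK U) :
    Letters313IM 𝔬 𝔭 Dd Dds R₀ H₀ hlen bHX bHW Bru θvu Bd Bd2 δ₃ δK U where
  rgdd μ ε hε := (h.rgdd μ ε hε).mono fun _ _ => mul_le_mul_of_nonneg_right (hBr ε hε) (Real.exp_nonneg _)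
  dgDvd := h.dgDvd
  pdgDvd := h.pdgDvd
  tDv ε hε := (h.tDv ε hε).mono fun _ _ => mul_le_mul_of_nonneg_right (hθv ε hε) (Real.exp_nonneg _)
  domX := h.domX
  locX := h.locX

omit [Fintype X] [Fintype Y] [Fintype Z] [Fintype W] [Fintype PX] [Fintype PY] [Fintype P] in
/-- Raising the constant of an exponential majorant. [folklore] -/
private theorem maj_mono_const₃ {F₁ F₂ : Type} [AddCommGroup F₁] [Module ℝ F₁] [AddCommGroup F₂] [Module ℝ F₂]
    {b₁ : BlockNorm (toB6 g R₀ H₀) F₁} {b₂ : BlockNorm (toB6 g R₀ H₀) F₂} {T : F₁ →ₗ[ℝ] F₂} {C C' δK : ℝ} (hCC' : C ≤ C')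
    (h : HasMaj b₁ b₂ T (fun a b => C * Real.exp (-(δK * g.dist a b)))) :
    HasMaj b₁ b₂ T (fun a b => C' * Real.exp (-(δK * g.dist a b))) :=
  h.mono fun _ _ => mul_le_mul_of_nonneg_right hCC' (Real.exp_nonneg _)

/-! ## §2 (3.44), (3.45) for 𝔊 per pair and on the family, indexed constants -/

omit [Fintype P] in
/-- ★ **(3.44) FOR 𝔊 = 𝔓G₁ PER DIRECTION PAIR, PRINTED SHAPE, ε-INDEXED STEP ∕ LETTER CONSTANTS** (B-twin of `B9Thm313WholeDirInput.GG_input44m_of_letters`) — ∇_{U,ν}𝔊∇\*_{U,μ} read from the input Hölder class `bHX ε` of X-functions into the block sup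
norm of X: |(∇_{U,ν}𝔊∇\*_{U,μ}λ)(x)| ≦ K·e^{−ρ₄d(y,y′)}(‖λ‖_ε + |λ|) for x ∈ Δ(y), supp λ ⊂ Δ̃(y′), K = `constI44 θ θ_D θ_H θ_v B₀ B₃ B_i(ε) B_d(ε) B_r Λ κ_W c`
(the sibling's constant).  Route: (3.153) with E = ∇_{U,ν}, F = ∇\*_{U,μ} (`GG_input_of_piecesF`); ∇_νG₁∇\*_μ and ∇_νG₁Dv by r1's right form (`input44_of_step` ∕
`input44_of_stepV` from Theorem 3.3's (3.44) per pair `Thm33G0Dir.h44m` ∕ the letter `Letters313IM.dgDvd`, the steps `StepDir.tDd1` ∕ `Letters313IM.tDv`,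
the per-direction left entry ∇_{U,ν}G₁ of `B9Thm312WholeLeft.entry1_of_stepD` (`Thm33G0Dir.e1d`, `StepDir.sDd1`) transferred by (2.60)); ∇_νG₁Q\* by
`hasMaj_left_right` (letters `Letters313DM.dgQsd`, `gQs2`) transferred by (2.60) to Z^{(1)} → 𝔠^{(0)}.  Provisos: ρ₄ + 3σ ≦ (1 − α)r, r ≦ δ₀, r ≦ δ₃,
r + σ ≦ δ_K, θc < 1 — the per-pair twin of `B9Thm313WholeInput.GG_input44_of_letters`.
[cite: Balaban1985BackgroundPropagators, Thm 3.13 p.426 + (3.153) p.426 + (3.44) p.398 + (3.39) p.397 + Thm 3.12 p.423 + p.398 (remark after (3.47)); Balaban1984PropagatorsII, Lemma 2.1 (2.60)–(2.61) p.234] -/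
theorem GG_input44m_of_lettersB (hG : GeoOK g) (𝔭 : HolderProbes g B X Y PX PY) {𝔬 : Ops g B X Y Z W} {U : B.Cfg}
    {Dd Dds : B.Cfg → P → Module.End ℝ (X → ℝ)}
    {bHX : ℝ → BlockNorm (toB6 g R₀ H₀) (X → ℝ)} {bHW : ℝ → BlockNorm (toB6 g R₀ H₀) (W → ℝ)} {bH : BlockNorm (toB6 g R₀ H₀) (W → ℝ)}
    {Bh Bi Bq Bd θH θI θv Br : ℝ → ℝ} {Bi2 Bd2 : ℝ → ℝ → ℝ} {θ θD B₀ B₃ δ₀ δ₃ δK r ρ₄ α Λ σ c ε : ℝ}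
    (hrow : RowSum (toB6 g R₀ H₀) σ c)
    (hc : 0 ≤ c) (hθ : 0 ≤ θ) (hθD : 0 ≤ θD) (hθH : 0 ≤ θI ε) (hθv : 0 ≤ θv ε) (hB₀ : 0 ≤ B₀) (hB₃ : 0 ≤ B₃) (hBi : 0 ≤ Bi ε)
    (hBd : 0 ≤ Bd ε) (hBr : 0 ≤ Br ε) (hΛ : 0 ≤ Λ) (hα : 0 ≤ α) (hσ : 0 ≤ σ) (hε0 : 0 < ε) (hε1 : ε ≤ 1) (hρ₄ : 0 ≤ ρ₄)
    (hρ₄r : ρ₄ + 3 * σ ≤ (1 - α) * r) (hr : 0 ≤ r) (hr0 : r ≤ δ₀) (hr₃ : r ≤ δ₃) (hrK : r + σ ≤ δK) (hq : θ * c < 1)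
    (hST : ScaleTransfer g r α Λ (fun y => g.len y ^ (1 : ℝ)))
    (hK1 : HasMaj (cNorm R₀ H₀ 𝔬.blk hG.lenle 1) (cNorm R₀ H₀ 𝔬.blk hG.lenle 1) (𝔬.G0 U ∘ₗ (𝔬.Tpi U + 𝔬.T2 U))
      (fun a b => θ * Real.exp (-(δK * g.dist a b))))
    (hK2 : HasMaj (cNorm R₀ H₀ 𝔬.blk hG.lenle 2) (cNorm R₀ H₀ 𝔬.blk hG.lenle 2) (𝔬.G0 U ∘ₗ (𝔬.Tpi U + 𝔬.T2 U))
      (fun a b => θ * Real.exp (-(δK * g.dist a b))))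
    (he0 : HasMajorant (g := toB6 g R₀ H₀) 𝔬.blk (𝔬.G0 U) (fun a b => B₀ * g.len a ^ 2 * Real.exp (-(δ₀ * g.dist a b))))
    (hH0 : Thm33G0Dir 𝔬 𝔭 Dd Dds R₀ H₀ bHX B₀ Bh Bi Bi2 δ₀ U) (hHR : Thm33G0DirR 𝔬 Dds R₀ H₀ B₀ δ₀ U)
    (hSD : StepDirB 𝔬 𝔭 Dd Dds R₀ H₀ bHX hG.lenle θD θH θI δK U)
    (hL : Letters313 𝔬 R₀ H₀ hG B₃ δ₃ U) (hLDM : Letters313DM 𝔬 𝔭 Dd R₀ H₀ hG B₃ Bq δ₃ bH U)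
    (hLIM : Letters313IMB 𝔬 𝔭 Dd Dds R₀ H₀ hG.lenle bHX bHW Br θv Bd Bd2 δ₃ δK U) (hI : Identities 𝔬 U) (ν μ : P) :
    HasMaj (bHX ε) (BlockNorm.ofBlocks (toB6 g R₀ H₀) 𝔬.blk) (Dd U ν ∘ₗ (𝔬.GG U ∘ₗ Dds U μ))
      (fun (a b : g.Site) => constI44 θ θD (θI ε) (θv ε) B₀ B₃ (Bi ε) (Bd ε) (Br ε) Λ (bHW ε).κ c * Real.exp (-(ρ₄ * g.dist a b))) := by
  -- adapted from `B9Thm313WholeInput.GG_input44_of_letters` (direction letters, X-inputs)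
  have hfix1 := fix_of_inverses hI.invG0' hI.invG1
  have hfixR := fix_right_of_inverses hI.invG0' hI.invG1
  have hq1 : 0 ≤ (1 - θ * c)⁻¹ := inv_nonneg.mpr (by linarith)
  have hA₁ : 0 ≤ B₀ * (1 - θ * c)⁻¹ := mul_nonneg hB₀ hq1
  have hA₃ : 0 ≤ B₃ * (1 - θ * c)⁻¹ := mul_nonneg hB₃ hq1
  have hCL : 0 ≤ B₀ + θD * (B₀ * (1 - θ * c)⁻¹) * c := add_nonneg hB₀ (mul_nonneg (mul_nonneg hθD hA₁) hc)
  have hKQ' : 0 ≤ B₃ + θD * (B₃ * (1 - θ * c)⁻¹) * c := add_nonneg hB₃ (mul_nonneg (mul_nonneg hθD hA₃) hc)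
  -- rates
  have h1α : (1 - α) * r ≤ r := by rw [sub_mul, one_mul]; exact sub_le_self _ (mul_nonneg hα hr)
  have hρ₂0 : 0 ≤ ρ₄ + 2 * σ := by linarith
  have hρ₂σ : ρ₄ + 2 * σ + σ ≤ (1 - α) * r := by linarith
  have hρ₂α : ρ₄ + 2 * σ ≤ (1 - α) * r := by linarith
  have hρ₂r : ρ₄ + 2 * σ ≤ r := by linarith
  have hρ₂K : ρ₄ + 2 * σ ≤ δK := by linarith
  have hρ₂0' : ρ₄ + 2 * σ ≤ δ₀ := by linarith
  have hρ₂₃ : ρ₄ + 2 * σ ≤ δ₃ := by linarith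
  have hρ₂₃σ : ρ₄ + 2 * σ + σ ≤ δ₃ := by linarith
  -- the per-direction left entry ∇_{U,ν}G₁ at the rate r
  have hm1 := entry1_of_stepD hG hrow hθ hθD hB₀ hr hr0 hrK hK2 (hSD.sDd1 ν) he0 (hH0.e1d ν) hfix1 hq
  -- ∇_νG₁∇*_μ from `bHX ε` and ∇_νG₁Dv from `bHW ε` by the right form
  have hGop := input44_of_step hG hrow hθH hBi hCL hΛ hρ₂0 hρ₂σ hρ₂K hρ₂0' hST hm1 (hH0.h44m (ν, μ) ε hε0 hε1)
    (hSD.tDd1 μ ε hε0) hfixR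
  have hGD := input44_of_stepV hG hrow hθv hBd hCL hΛ hρ₂0 hρ₂σ hρ₂K hρ₂₃ hST hm1 (hLIM.dgDvd ν ε hε0 hε1) (hLIM.tDv ε hε0)
    hfixR
  -- ∇_νG₁Q* : Z⁰ → 𝔠⁽¹⁾ by the left form, then (2.60): Z^{(1)} → 𝔠^{(0)}
  have hGQr := hasMaj_right_of_step hG hrow hθ hB₃ hr hr₃ hrK hK2 hL.gQs2 hfix1 hq
  have hDQ := hasMaj_left_right hG hrow hθD hB₃ hA₃ hr hr₃ le_rfl hrK (hSD.sDd1 ν) (hLDM.dgQsd ν) hGQr hfix1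
  have hDQR : HasMaj (cNormR R₀ H₀ 𝔬.blkZ hG.lenle 0) (cNormR R₀ H₀ 𝔬.blk hG.lenle (-1)) (Dd U ν ∘ₗ 𝔬.G1 U ∘ₗ 𝔬.Qstar U)
      (fun y y' => (B₃ + θD * (B₃ * (1 - θ * c)⁻¹) * c) * Real.exp (-(r * g.dist y y'))) := by
    have h := hasMaj_toR hG hDQ
    simp only [Nat.cast_zero, neg_zero, Nat.cast_one] at h
    exact h
  have hDQT := hasMaj_transfer hG hKQ' hST hDQR
  have e1 : (0 : ℝ) + 1 = 1 := by ring
  have e2 : (-1 : ℝ) + 1 = 0 := by ring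
  rw [e1, e2] at hDQT
  have hGQ : HasMaj (cNormR R₀ H₀ 𝔬.blkZ hG.lenle 1) (BlockNorm.ofBlocks (toB6 g R₀ H₀) 𝔬.blk) (Dd U ν ∘ₗ 𝔬.G1 U ∘ₗ 𝔬.Qstar U)
      (fun a b => (B₃ + θD * (B₃ * (1 - θ * c)⁻¹) * c) * Λ * Real.exp (-((ρ₄ + 2 * σ) * g.dist a b))) :=
    hasMaj_of_out_zero (hDQT.of_rate_le hG.dnn (mul_nonneg hKQ' hΛ) hρ₂α)
  -- (3.153)
  have h := GG_input_of_piecesF hG hrow hc hθ hB₀ hB₃ hBr (add_nonneg hBi (mul_nonneg (mul_nonneg (mul_nonneg hCL hΛ) hθH) hc))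
    (add_nonneg hBd (mul_nonneg (mul_nonneg (mul_nonneg hCL hΛ) hθv) hc)) (mul_nonneg hKQ' hΛ) hσ hρ₄ le_rfl hρ₂r hρ₂₃σ hr hr0 hrK hq
    hK1 (hHR.e2d μ) hL hI (hLIM.domX ε hε0) (hLIM.locX ε hε0) (hLIM.rgdd μ ε hε0) hGop hGD hGQ
  refine h.mono fun a b => le_of_eq ?_
  simp only [constI44]

omit [Fintype P] in
/-- ★ **(3.45) FOR 𝔊 = 𝔓G₁ PER DIRECTION PAIR, PRINTED SHAPE, β∕ε-INDEXED CONSTANTS** (B-twin of `…GG_input45m_of_letters`; probe step at β and input step at β + ε read at θ_M = max(θ_H β, θ_I (β+ε))) — Φ^X_β∘∇_{U,ν}𝔊∇\*_{U,μ} read from the input Hölder class `bHX (β+ε)` into the probe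
blocks of X: ‖ζ∇_{U,ν}𝔊∇\*_{U,μ}λ‖_β-type bound K·(Lʲη)^{−β}·e^{−ρ₄d(y,y′)}(‖λ‖_{β+ε} + |λ|), K = `constI45 θ θ_H θ_v B₀ B₃ B_h B_i2 B_d2 B_q B_r Λ κ_W c`
(the sibling's constant).  Route: (3.153) with E = Φ^X_β∘∇_{U,ν} in the real class 𝔠_P^{(β)} (`GG_input_of_piecesF`); Φ^X_β∇_νG₁∇\*_μ and Φ^X_β∇_νG₁Dv
by the right form (`input45_of_step` from Theorem 3.3's (3.45) per pair `Thm33G0Dir.h45m` ∕ the letter `Letters313IM.pdgDvd`, the steps `StepDir.tDd1` ∕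
`Letters313IM.tDv`, the probe entry `B9Thm312WholeDir.probe43d_cNormR` from `Thm33G0Dir.h43d` ∕ `StepDir.pXd1`); Φ^X_β∇_νG₁Q\* by `hasMaj_left_rightR`
(letters `Letters313DM.pQd`, `gQs2`, the probe step `pXd1`) transferred by (2.60).  Provisos as for (3.44) — the per-pair twin of
`B9Thm313WholeInput.GG_input45_of_letters`.
[cite: Balaban1985BackgroundPropagators, Thm 3.13 p.426 + (3.153) p.426 + (3.45) p.398 + (3.39)–(3.40) p.397 + Thm 3.12 p.423 + p.398 (remark after (3.47)); Balaban1984PropagatorsII, Lemma 2.1 (2.60)–(2.61) p.234] -/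
theorem GG_input45m_of_lettersB (hG : GeoOK g) (𝔭 : HolderProbes g B X Y PX PY) {𝔬 : Ops g B X Y Z W} {U : B.Cfg}
    {Dd Dds : B.Cfg → P → Module.End ℝ (X → ℝ)}
    {bHX : ℝ → BlockNorm (toB6 g R₀ H₀) (X → ℝ)} {bHW : ℝ → BlockNorm (toB6 g R₀ H₀) (W → ℝ)} {bH : BlockNorm (toB6 g R₀ H₀) (W → ℝ)}
    {Bh Bi Bq Bd θH θI θv Br : ℝ → ℝ} {Bi2 Bd2 : ℝ → ℝ → ℝ} {θ θD B₀ B₃ β δ₀ δ₃ δK r ρ₄ α Λ σ c ε : ℝ}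
    (hrow : RowSum (toB6 g R₀ H₀) σ c)
    (hc : 0 ≤ c) (hθ : 0 ≤ θ) (hθH : 0 ≤ θH β) (hθv : 0 ≤ θv (β + ε)) (hB₀ : 0 ≤ B₀) (hB₃ : 0 ≤ B₃)
    (hBh : 0 ≤ Bh β) (hBi2 : 0 ≤ Bi2 ε β)
    (hBq : 0 ≤ Bq β) (hBd2 : 0 ≤ Bd2 ε β) (hBr : 0 ≤ Br (β + ε)) (hΛ : 0 ≤ Λ) (hα : 0 ≤ α) (hσ : 0 ≤ σ) (hε0 : 0 < ε) (hε1 : ε ≤ 1)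
    (hβ0 : 0 ≤ β) (hβ1 : β < 1) (hρ₄ : 0 ≤ ρ₄) (hρ₄r : ρ₄ + 3 * σ ≤ (1 - α) * r) (hr : 0 ≤ r) (hr0 : r ≤ δ₀) (hr₃ : r ≤ δ₃)
    (hrK : r + σ ≤ δK) (hq : θ * c < 1) (hST : ScaleTransfer g r α Λ (fun y => g.len y ^ (1 : ℝ)))
    (hK1 : HasMaj (cNorm R₀ H₀ 𝔬.blk hG.lenle 1) (cNorm R₀ H₀ 𝔬.blk hG.lenle 1) (𝔬.G0 U ∘ₗ (𝔬.Tpi U + 𝔬.T2 U))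
      (fun a b => θ * Real.exp (-(δK * g.dist a b))))
    (hK2 : HasMaj (cNorm R₀ H₀ 𝔬.blk hG.lenle 2) (cNorm R₀ H₀ 𝔬.blk hG.lenle 2) (𝔬.G0 U ∘ₗ (𝔬.Tpi U + 𝔬.T2 U))
      (fun a b => θ * Real.exp (-(δK * g.dist a b))))
    (he0 : HasMajorant (g := toB6 g R₀ H₀) 𝔬.blk (𝔬.G0 U) (fun a b => B₀ * g.len a ^ 2 * Real.exp (-(δ₀ * g.dist a b))))
    (hH0 : Thm33G0Dir 𝔬 𝔭 Dd Dds R₀ H₀ bHX B₀ Bh Bi Bi2 δ₀ U) (hHR : Thm33G0DirR 𝔬 Dds R₀ H₀ B₀ δ₀ U)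
    (hSD : StepDirB 𝔬 𝔭 Dd Dds R₀ H₀ bHX hG.lenle θD θH θI δK U)
    (hL : Letters313 𝔬 R₀ H₀ hG B₃ δ₃ U) (hLDM : Letters313DM 𝔬 𝔭 Dd R₀ H₀ hG B₃ Bq δ₃ bH U)
    (hLIM : Letters313IMB 𝔬 𝔭 Dd Dds R₀ H₀ hG.lenle bHX bHW Br θv Bd Bd2 δ₃ δK U) (hI : Identities 𝔬 U) (ν μ : P) :
    HasMaj (bHX (β + ε)) (BlockNorm.ofBlocks (toB6 g R₀ H₀) 𝔭.blkPX) ((𝔭.ΦX U β ∘ₗ Dd U ν) ∘ₗ (𝔬.GG U ∘ₗ Dds U μ))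
      (fun (a b : g.Site) => constI45 θ (max (θH β) (θI (β + ε))) (θv (β + ε)) B₀ B₃ (Bh β) (Bi2 ε β) (Bd2 ε β) (Bq β) (Br (β + ε)) Λ
        (bHW (β + ε)).κ c * g.len a ^ (-β) * Real.exp (-(ρ₄ * g.dist a b))) := by
  -- adapted from `B9Thm313WholeDirInput.GG_input45m_of_letters`: the probe step at β and the input step at β + ε are read at the common constant θ_M
  set θM : ℝ := max (θH β) (θI (β + ε)) with hθMdef
  have hθM : 0 ≤ θM := le_max_of_le_left hθH
  have htri : Triangle254 (toB6 g R₀ H₀) := fun a b c => hG.tri a b c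
  have hfix1 := fix_of_inverses hI.invG0' hI.invG1
  have hfixR := fix_right_of_inverses hI.invG0' hI.invG1
  have hq1 : 0 ≤ (1 - θ * c)⁻¹ := inv_nonneg.mpr (by linarith)
  have hA₁ : 0 ≤ B₀ * (1 - θ * c)⁻¹ := mul_nonneg hB₀ hq1
  have hA₃ : 0 ≤ B₃ * (1 - θ * c)⁻¹ := mul_nonneg hB₃ hq1
  have hCh : 0 ≤ Bh β + θM * (B₀ * (1 - θ * c)⁻¹) * c := add_nonneg hBh (mul_nonneg (mul_nonneg hθM hA₁) hc)
  have hKQ' : 0 ≤ Bq β + θM * (B₃ * (1 - θ * c)⁻¹) * c := add_nonneg hBq (mul_nonneg (mul_nonneg hθM hA₃) hc)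
  have hε' : 0 < β + ε := by linarith
  have hpXdM : HasMaj (cNormR R₀ H₀ 𝔬.blk hG.lenle (-2)) (cNormR R₀ H₀ 𝔭.blkPX hG.lenle (β - 1))
      ((𝔭.ΦX U β ∘ₗ Dd U ν ∘ₗ 𝔬.G0 U) ∘ₗ (𝔬.Tpi U + 𝔬.T2 U)) (fun a b => θM * Real.exp (-(δK * g.dist a b))) :=
    maj_mono_const₃ (le_max_left _ _) (hSD.pXd1 ν β hβ0 hβ1)
  have htDdM : HasMaj (bHX (β + ε)) (cNormR R₀ H₀ 𝔬.blk hG.lenle 1) ((𝔬.Tpi U + 𝔬.T2 U) ∘ₗ (𝔬.G0 U ∘ₗ Dds U μ))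
      (fun a b => θM * Real.exp (-(δK * g.dist a b))) :=
    maj_mono_const₃ (le_max_right _ _) (hSD.tDd1 μ (β + ε) hε')
  -- rates
  have h1α : (1 - α) * r ≤ r := by rw [sub_mul, one_mul]; exact sub_le_self _ (mul_nonneg hα hr)
  have hρ₂0 : 0 ≤ ρ₄ + 2 * σ := by linarith
  have hρ₂σ : ρ₄ + 2 * σ + σ ≤ (1 - α) * r := by linarith
  have hρ₂α : ρ₄ + 2 * σ ≤ (1 - α) * r := by linarith
  have hρ₂r : ρ₄ + 2 * σ ≤ r := by linarith
  have hρ₂K : ρ₄ + 2 * σ ≤ δK := by linarith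
  have hρ₂0' : ρ₄ + 2 * σ ≤ δ₀ := by linarith
  have hρ₂₃ : ρ₄ + 2 * σ ≤ δ₃ := by linarith
  have hρ₂₃σ : ρ₄ + 2 * σ + σ ≤ δ₃ := by linarith
  set E : (X → ℝ) →ₗ[ℝ] (PX → ℝ) := 𝔭.ΦX U β ∘ₗ Dd U ν with hE
  -- the probe entry Φ^X_β∇_νG₁ : 𝔠^{(0)} → 𝔠_P^{(β−1)} at the rate r
  have hA := probe43d_cNormR hG hrow hθ hθM hB₀ hBh hr hr0 hrK hK2 he0 (hH0.h43d ν β hβ0 hβ1) hpXdM hfix1 hq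
  -- Φ∇_νG₁∇*_μ from `bHX (β+ε)` and Φ∇_νG₁Dv from `bHW (β+ε)` by the right form, into 𝔠_P^{(β)}
  have h45' : HasMaj (bHX (β + ε)) (BlockNorm.ofBlocks (toB6 g R₀ H₀) 𝔭.blkPX) (E ∘ₗ (𝔬.G0 U ∘ₗ Dds U μ))
      (fun (a b : g.Site) => Bi2 ε β * g.len a ^ (-β) * Real.exp (-(δ₀ * g.dist a b))) := hH0.h45m (ν, μ) ε β hε0 hε1 hβ0 hβ1
  have hGop' := input45_of_step hG hrow hθM hBi2 hCh hΛ hρ₂0 hρ₂σ hρ₂K hρ₂0' hST hA h45' htDdM hfixR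
  have hGop : HasMaj (bHX (β + ε)) (cNormR R₀ H₀ 𝔭.blkPX hG.lenle β) (E ∘ₗ (𝔬.G1 U ∘ₗ Dds U μ))
      (fun a b => (Bi2 ε β + (Bh β + θM * (B₀ * (1 - θ * c)⁻¹) * c) * Λ * θM * c) * Real.exp (-((ρ₄ + 2 * σ) * g.dist a b))) :=
    hasMaj_weight_out hG (hGop'.mono fun a b => le_of_eq (by ring))
  have hpd : HasMaj (bHW (β + ε)) (BlockNorm.ofBlocks (toB6 g R₀ H₀) 𝔭.blkPX) (E ∘ₗ (𝔬.G0 U ∘ₗ 𝔬.Dv U))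
      (fun (a b : g.Site) => Bd2 ε β * g.len a ^ (-β) * Real.exp (-(δ₃ * g.dist a b))) := hLIM.pdgDvd ν ε β hε0 hε1 hβ0 hβ1
  have hGD' := input45_of_step hG hrow hθv hBd2 hCh hΛ hρ₂0 hρ₂σ hρ₂K hρ₂₃ hST hA hpd (hLIM.tDv (β + ε) hε') hfixR
  have hGD : HasMaj (bHW (β + ε)) (cNormR R₀ H₀ 𝔭.blkPX hG.lenle β) (E ∘ₗ (𝔬.G1 U ∘ₗ 𝔬.Dv U))
      (fun a b => (Bd2 ε β + (Bh β + θM * (B₀ * (1 - θ * c)⁻¹) * c) * Λ * θv (β + ε) * c) *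
        Real.exp (-((ρ₄ + 2 * σ) * g.dist a b))) :=
    hasMaj_weight_out hG (hGD'.mono fun a b => le_of_eq (by ring))
  -- Φ∇_νG₁Q* : Z^{(0)} → 𝔠_P^{(β−1)} by the left form over the real middle class 𝔠^{(−2)}, then (2.60): 𝔠_Z^{(1)} → 𝔠_P^{(β)}
  have hGQr : HasMaj (cNormR R₀ H₀ 𝔬.blkZ hG.lenle 0) (cNormR R₀ H₀ 𝔬.blk hG.lenle (-2)) (𝔬.G1 U ∘ₗ 𝔬.Qstar U)
      (fun a b => B₃ * (1 - θ * c)⁻¹ * Real.exp (-(r * g.dist a b))) := by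
    have h := hasMaj_toR hG (hasMaj_right_of_step hG hrow hθ hB₃ hr hr₃ hrK hK2 hL.gQs2 hfix1 hq)
    simp only [Nat.cast_zero, neg_zero, Nat.cast_ofNat] at h
    exact h
  have hpQ' : HasMaj (cNormR R₀ H₀ 𝔬.blkZ hG.lenle 0) (cNormR R₀ H₀ 𝔭.blkPX hG.lenle (β - 1)) (E ∘ₗ 𝔬.G0 U ∘ₗ 𝔬.Qstar U)
      (fun a b => Bq β * Real.exp (-(δ₃ * g.dist a b))) := hLDM.pQd ν β hβ0 hβ1
  have hKE : HasMaj (cNormR R₀ H₀ 𝔬.blk hG.lenle (-2)) (cNormR R₀ H₀ 𝔭.blkPX hG.lenle (β - 1))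
      (E ∘ₗ 𝔬.G0 U ∘ₗ (𝔬.Tpi U + 𝔬.T2 U)) (fun a b => θM * Real.exp (-(δK * g.dist a b))) := hpXdM
  have hDQ := hasMaj_left_rightR hG hrow hθM hBq hA₃ hr hr₃ le_rfl hrK hKE hpQ' hGQr hfix1
  have hDQT := hasMaj_transfer hG hKQ' hST hDQ
  have e1 : (0 : ℝ) + 1 = 1 := by ring
  have e2 : β - 1 + 1 = β := by ring
  rw [e1, e2] at hDQT
  have hGQ : HasMaj (cNormR R₀ H₀ 𝔬.blkZ hG.lenle 1) (cNormR R₀ H₀ 𝔭.blkPX hG.lenle β) (E ∘ₗ 𝔬.G1 U ∘ₗ 𝔬.Qstar U)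
      (fun a b => (Bq β + θM * (B₃ * (1 - θ * c)⁻¹) * c) * Λ * Real.exp (-((ρ₄ + 2 * σ) * g.dist a b))) :=
    hDQT.of_rate_le hG.dnn (mul_nonneg hKQ' hΛ) hρ₂α
  -- (3.153) in 𝔠_P^{(β)}, then unweighted
  have h := GG_input_of_piecesF hG hrow hc hθ hB₀ hB₃ hBr (add_nonneg hBi2 (mul_nonneg (mul_nonneg (mul_nonneg hCh hΛ) hθM) hc))
    (add_nonneg hBd2 (mul_nonneg (mul_nonneg (mul_nonneg hCh hΛ) hθv) hc)) (mul_nonneg hKQ' hΛ) hσ hρ₄ le_rfl hρ₂r hρ₂₃σ hr hr0 hrK hq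
    hK1 (hHR.e2d μ) hL hI (hLIM.domX (β + ε) hε') (hLIM.locX (β + ε) hε') (hLIM.rgdd μ (β + ε) hε') hGop hGD hGQ
  have hu := hasMaj_unweight_out hG h
  refine hu.mono fun a b => le_of_eq ?_
  simp only [constI45]
  ring

/-- ★ **(3.44) FOR 𝔊 ON THE PACKAGED PAIR FAMILY, ε-INDEXED CONSTANTS** (B-twin) — `GG_input44m_of_letters` for every pair, packaged WITHOUT a |P| factor (`hasMaj_familyOp'`: sup sizes):
the family `familyOp (q ↦ ∇_{U,q.1} ∘ 𝔊 ∘ ∇\*_{U,q.2})` read from `bHX ε` into the sharp blocks of X × (P × P) (block map `blk ∘ Prod.fst`) — the input `h44`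
of n06-k's `lines3445_of_hasMaj_fam` for 𝔊's kernel family. [cite: Balaban1985BackgroundPropagators, Thm 3.13 p.426 + (3.44) p.398 + (3.39) p.397] -/
theorem GG_input44Family_of_lettersB (hG : GeoOK g) (𝔭 : HolderProbes g B X Y PX PY) {𝔬 : Ops g B X Y Z W} {U : B.Cfg}
    {Dd Dds : B.Cfg → P → Module.End ℝ (X → ℝ)}
    {bHX : ℝ → BlockNorm (toB6 g R₀ H₀) (X → ℝ)} {bHW : ℝ → BlockNorm (toB6 g R₀ H₀) (W → ℝ)} {bH : BlockNorm (toB6 g R₀ H₀) (W → ℝ)}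
    {Bh Bi Bq Bd θH θI θv Br : ℝ → ℝ} {Bi2 Bd2 : ℝ → ℝ → ℝ} {θ θD B₀ B₃ δ₀ δ₃ δK r ρ₄ α Λ σ c ε : ℝ}
    (hrow : RowSum (toB6 g R₀ H₀) σ c)
    (hc : 0 ≤ c) (hθ : 0 ≤ θ) (hθD : 0 ≤ θD) (hθH : 0 ≤ θI ε) (hθv : 0 ≤ θv ε) (hB₀ : 0 ≤ B₀) (hB₃ : 0 ≤ B₃) (hBi : 0 ≤ Bi ε)
    (hBd : 0 ≤ Bd ε) (hBr : 0 ≤ Br ε) (hΛ : 0 ≤ Λ) (hα : 0 ≤ α) (hσ : 0 ≤ σ) (hε0 : 0 < ε) (hε1 : ε ≤ 1) (hρ₄ : 0 ≤ ρ₄)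
    (hρ₄r : ρ₄ + 3 * σ ≤ (1 - α) * r) (hr : 0 ≤ r) (hr0 : r ≤ δ₀) (hr₃ : r ≤ δ₃) (hrK : r + σ ≤ δK) (hq : θ * c < 1)
    (hST : ScaleTransfer g r α Λ (fun y => g.len y ^ (1 : ℝ)))
    (hK1 : HasMaj (cNorm R₀ H₀ 𝔬.blk hG.lenle 1) (cNorm R₀ H₀ 𝔬.blk hG.lenle 1) (𝔬.G0 U ∘ₗ (𝔬.Tpi U + 𝔬.T2 U))
      (fun a b => θ * Real.exp (-(δK * g.dist a b))))
    (hK2 : HasMaj (cNorm R₀ H₀ 𝔬.blk hG.lenle 2) (cNorm R₀ H₀ 𝔬.blk hG.lenle 2) (𝔬.G0 U ∘ₗ (𝔬.Tpi U + 𝔬.T2 U))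
      (fun a b => θ * Real.exp (-(δK * g.dist a b))))
    (he0 : HasMajorant (g := toB6 g R₀ H₀) 𝔬.blk (𝔬.G0 U) (fun a b => B₀ * g.len a ^ 2 * Real.exp (-(δ₀ * g.dist a b))))
    (hH0 : Thm33G0Dir 𝔬 𝔭 Dd Dds R₀ H₀ bHX B₀ Bh Bi Bi2 δ₀ U) (hHR : Thm33G0DirR 𝔬 Dds R₀ H₀ B₀ δ₀ U)
    (hSD : StepDirB 𝔬 𝔭 Dd Dds R₀ H₀ bHX hG.lenle θD θH θI δK U)
    (hL : Letters313 𝔬 R₀ H₀ hG B₃ δ₃ U) (hLDM : Letters313DM 𝔬 𝔭 Dd R₀ H₀ hG B₃ Bq δ₃ bH U)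
    (hLIM : Letters313IMB 𝔬 𝔭 Dd Dds R₀ H₀ hG.lenle bHX bHW Br θv Bd Bd2 δ₃ δK U) (hI : Identities 𝔬 U) :
    HasMaj (bHX ε) (BlockNorm.ofBlocks (toB6 g R₀ H₀) (𝔬.blk ∘ Prod.fst))
      (familyOp (fun q : P × P => Dd U q.1 ∘ₗ (𝔬.GG U ∘ₗ Dds U q.2)))
      (fun (a b : g.Site) => constI44 θ θD (θI ε) (θv ε) B₀ B₃ (Bi ε) (Bd ε) (Br ε) Λ (bHW ε).κ c * Real.exp (-(ρ₄ * g.dist a b))) := by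
  have hq1 : 0 ≤ (1 - θ * c)⁻¹ := inv_nonneg.mpr (by linarith)
  have hK0 : 0 ≤ constI44 θ θD (θI ε) (θv ε) B₀ B₃ (Bi ε) (Bd ε) (Br ε) Λ (bHW ε).κ c := by
    have hκ := (bHW ε).κ_nonneg
    unfold constI44
    positivity
  exact hasMaj_familyOp' (R := R₀) (H := H₀) 𝔬.blk (fun a b => mul_nonneg hK0 (Real.exp_nonneg _))
    fun q => GG_input44m_of_lettersB hG 𝔭 hrow hc hθ hθD hθH hθv hB₀ hB₃ hBi hBd hBr hΛ hα hσ hε0 hε1 hρ₄ hρ₄r hr hr0 hr₃ hrK hq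
      hST hK1 hK2 he0 hH0 hHR hSD hL hLDM hLIM hI q.1 q.2

/-- ★ **(3.45) FOR 𝔊 ON THE PACKAGED PAIR FAMILY, PROBES SLICED, β∕ε-INDEXED CONSTANTS** (B-twin) — `GG_input45m_of_letters` for every pair, the X-probes sliced over the family
(`sliceProbe_comp_familyOp`) and packaged without a |P| factor (`hasMaj_familyOp'`): `sliceProbe Φ^X_β ∘ familyOp (q ↦ ∇_{U,q.1}𝔊∇\*_{U,q.2})` read from
`bHX (β+ε)` into the probe blocks (block map `blkPX ∘ Prod.fst`) — the input `h45` of n06-k's `lines3445_of_hasMaj_fam` for 𝔊's kernel family.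
[cite: Balaban1985BackgroundPropagators, Thm 3.13 p.426 + (3.45) p.398 + (3.39)–(3.40) p.397] -/
theorem GG_input45Family_of_lettersB (hG : GeoOK g) (𝔭 : HolderProbes g B X Y PX PY) {𝔬 : Ops g B X Y Z W} {U : B.Cfg}
    {Dd Dds : B.Cfg → P → Module.End ℝ (X → ℝ)}
    {bHX : ℝ → BlockNorm (toB6 g R₀ H₀) (X → ℝ)} {bHW : ℝ → BlockNorm (toB6 g R₀ H₀) (W → ℝ)} {bH : BlockNorm (toB6 g R₀ H₀) (W → ℝ)}
    {Bh Bi Bq Bd θH θI θv Br : ℝ → ℝ} {Bi2 Bd2 : ℝ → ℝ → ℝ} {θ θD B₀ B₃ β δ₀ δ₃ δK r ρ₄ α Λ σ c ε : ℝ}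
    (hrow : RowSum (toB6 g R₀ H₀) σ c)
    (hc : 0 ≤ c) (hθ : 0 ≤ θ) (hθH : 0 ≤ θH β) (hθv : 0 ≤ θv (β + ε)) (hB₀ : 0 ≤ B₀) (hB₃ : 0 ≤ B₃)
    (hBh : 0 ≤ Bh β) (hBi2 : 0 ≤ Bi2 ε β)
    (hBq : 0 ≤ Bq β) (hBd2 : 0 ≤ Bd2 ε β) (hBr : 0 ≤ Br (β + ε)) (hΛ : 0 ≤ Λ) (hα : 0 ≤ α) (hσ : 0 ≤ σ) (hε0 : 0 < ε) (hε1 : ε ≤ 1)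
    (hβ0 : 0 ≤ β) (hβ1 : β < 1) (hρ₄ : 0 ≤ ρ₄) (hρ₄r : ρ₄ + 3 * σ ≤ (1 - α) * r) (hr : 0 ≤ r) (hr0 : r ≤ δ₀) (hr₃ : r ≤ δ₃)
    (hrK : r + σ ≤ δK) (hq : θ * c < 1) (hST : ScaleTransfer g r α Λ (fun y => g.len y ^ (1 : ℝ)))
    (hK1 : HasMaj (cNorm R₀ H₀ 𝔬.blk hG.lenle 1) (cNorm R₀ H₀ 𝔬.blk hG.lenle 1) (𝔬.G0 U ∘ₗ (𝔬.Tpi U + 𝔬.T2 U))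
      (fun a b => θ * Real.exp (-(δK * g.dist a b))))
    (hK2 : HasMaj (cNorm R₀ H₀ 𝔬.blk hG.lenle 2) (cNorm R₀ H₀ 𝔬.blk hG.lenle 2) (𝔬.G0 U ∘ₗ (𝔬.Tpi U + 𝔬.T2 U))
      (fun a b => θ * Real.exp (-(δK * g.dist a b))))
    (he0 : HasMajorant (g := toB6 g R₀ H₀) 𝔬.blk (𝔬.G0 U) (fun a b => B₀ * g.len a ^ 2 * Real.exp (-(δ₀ * g.dist a b))))
    (hH0 : Thm33G0Dir 𝔬 𝔭 Dd Dds R₀ H₀ bHX B₀ Bh Bi Bi2 δ₀ U) (hHR : Thm33G0DirR 𝔬 Dds R₀ H₀ B₀ δ₀ U)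
    (hSD : StepDirB 𝔬 𝔭 Dd Dds R₀ H₀ bHX hG.lenle θD θH θI δK U)
    (hL : Letters313 𝔬 R₀ H₀ hG B₃ δ₃ U) (hLDM : Letters313DM 𝔬 𝔭 Dd R₀ H₀ hG B₃ Bq δ₃ bH U)
    (hLIM : Letters313IMB 𝔬 𝔭 Dd Dds R₀ H₀ hG.lenle bHX bHW Br θv Bd Bd2 δ₃ δK U) (hI : Identities 𝔬 U) :
    HasMaj (bHX (β + ε)) (BlockNorm.ofBlocks (toB6 g R₀ H₀) (𝔭.blkPX ∘ Prod.fst))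
      (sliceProbe (𝔭.ΦX U β) ∘ₗ familyOp (fun q : P × P => Dd U q.1 ∘ₗ (𝔬.GG U ∘ₗ Dds U q.2)))
      (fun (a b : g.Site) => constI45 θ (max (θH β) (θI (β + ε))) (θv (β + ε)) B₀ B₃ (Bh β) (Bi2 ε β) (Bd2 ε β) (Bq β) (Br (β + ε)) Λ
        (bHW (β + ε)).κ c * g.len a ^ (-β) * Real.exp (-(ρ₄ * g.dist a b))) := by
  have hq1 : 0 ≤ (1 - θ * c)⁻¹ := inv_nonneg.mpr (by linarith)
  have hK0 : 0 ≤ constI45 θ (max (θH β) (θI (β + ε))) (θv (β + ε)) B₀ B₃ (Bh β) (Bi2 ε β) (Bd2 ε β) (Bq β) (Br (β + ε)) Λ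
      (bHW (β + ε)).κ c := by
    have hκ := (bHW (β + ε)).κ_nonneg
    unfold constI45
    positivity
  rw [sliceProbe_comp_familyOp]
  refine hasMaj_familyOp' (R := R₀) (H := H₀) 𝔭.blkPX
    (fun a b => mul_nonneg (mul_nonneg hK0 (Real.rpow_nonneg (hG.lenle a) _)) (Real.exp_nonneg _)) fun q => ?_
  have h := GG_input45m_of_lettersB hG 𝔭 hrow hc hθ hθH hθv hB₀ hB₃ hBh hBi2 hBq hBd2 hBr hΛ hα hσ hε0 hε1 hβ0 hβ1 hρ₄ hρ₄r hr hr0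
    hr₃ hrK hq hST hK1 hK2 he0 hH0 hHR hSD hL hLDM hLIM hI q.1 q.2
  exact h.congr fun μ => rfl

end OneMember

end

end Literature.MathematicalPhysics.QuantumFieldTheory.Balaban1983to89.B9Thm313WholeDirInputB
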